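import Literature.Computability.AlgebraicComplexity.CircuitArithmetization
import Literature.Computability.AlgebraicComplexity.PermanentCompleteness
import HarnessLib

/-!
# The transcript arithmetization of a Boolean circuit is an arithmetic *expression* (formula)

`Literature.Computability.AlgebraicComplexity.CircuitArithmetization` builds, for a `B₂`-circuit
`Q` with `s` gates, the polynomial `VALID(Q) = ∏_j [Y_j = T_j(args)] ∈ k[X_ι, Y_1, …, Y_s]`
(`CircuitArith.validPoly`) whose Boolean sum over the gate variables `Y` collapses to the unique
correct transcript (`CircuitArith.sum_eval_validPoly_mul`), and bounds its *circuit* size.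
For Valiant's completeness theorem in the expression form of Bürgisser–Clausen–Shokrollahi
(BCS 1997, Thm. (21.27): "every expression of size `u` is a projection of `PER_{2u+2}`", the
tree's PROVED `BCS1997_thm_21_27_holds`, stated for the inductive type `ArithExpr` of
`PermanentCompleteness.lean`) one needs the same polynomial as an *expression* of size `O(s)`.
This file provides it:

* `ArithExpr.rename`, `ArithExpr.listProd`, `ArithExpr.oneSub` with their `eval`/`size` lemmas
  (generic expression plumbing);
* `CircuitArith.litE`, `tableExtE`, `eqIndE`, `wirePolyE`, `argPolyE`, `consPolyE`, `validPolyE`: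
  expressions mirroring `lit`, `tableExt`, `eqInd`, `wirePoly`, `argPoly`, `consPoly`,
  `validPoly` literally, with `eval_…E : (…E).eval = …` and the size bound
  `size_validPolyE_le : E(VALID(Q)) ≤ 54 |Q|`.

`VALID` is by construction a product over the gates of constant-size polynomials in at most
three variables, i.e. a formula of linear size (Bürgisser 2000, proof of Prop. 2.20: "`G_n` is
an expression of size `O(|C_n|)`"); nothing here is deep, the point is the bookkeeping in the
`ArithExpr` carrier expected by `BCS1997_thm_21_27`.

## References

* P. Bürgisser, *Completeness and Reduction in Algebraic Complexity Theory*, Springer 2000,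
  Prop. 2.20 (Valiant's criterion) and its proof.
* P. Bürgisser, M. Clausen, M. A. Shokrollahi, *Algebraic Complexity Theory*, Springer 1997,
  (21.19) (expressions and their size), Thm. (21.27).
* L. G. Valiant, *Completeness classes in algebra*, STOC 1979, §4.
-/

noncomputable section

open MvPolynomial

universe u v w

namespace Literature.Computability.AlgebraicComplexity

/-! ### Expression plumbing: renaming, list products, `1 - φ` -/

namespace ArithExpr

variable {k : Type u} {σ : Type v} {τ : Type w}

/-- Renaming the variables of an expression (BCS 1997, (21.19): substituting indeterminates for
indeterminates does not change the size). [cite: BurgisserClausenShokrollahi1997, (21.19)] -/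
def rename (f : σ → τ) : ArithExpr k σ → ArithExpr k τ
  | var i => var (f i)
  | const c => const c
  | add φ₁ φ₂ => add (rename f φ₁) (rename f φ₂)
  | mul φ₁ φ₂ => mul (rename f φ₁) (rename f φ₂)

/-- Renaming preserves the size. [cite: BurgisserClausenShokrollahi1997, (21.19)] -/
@[simp] theorem size_rename (f : σ → τ) (φ : ArithExpr k σ) : (φ.rename f).size = φ.size := by
  induction φ with
  | var i => rfl
  | const c => rfl
  | add φ₁ φ₂ ih₁ ih₂ => simp [rename, ih₁, ih₂]
  | mul φ₁ φ₂ ih₁ ih₂ => simp [rename, ih₁, ih₂]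

variable [CommRing k]

/-- The product of a list of expressions (right-nested; the empty product is the constant `1`). [cite: BurgisserClausenShokrollahi1997, (21.19)] -/
def listProd : List (ArithExpr k σ) → ArithExpr k σ
  | [] => const 1
  | φ :: l => mul φ (listProd l)

/-- Size of a list product: the sizes of the factors plus one multiplication per factor. [cite: BurgisserClausenShokrollahi1997, (21.19)] -/
theorem size_listProd (l : List (ArithExpr k σ)) : (listProd l).size = (l.map size).sum + l.length := by
  induction l with
  | nil => rfl
  | cons φ l ih => simp only [listProd, size_mul, ih, List.map_cons, List.sum_cons, List.length_cons]; omega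

/-- Renaming commutes with evaluation: `val(φ.rename f) = rename f (val φ)`. [cite: BurgisserClausenShokrollahi1997, (21.19)] -/
@[simp] theorem eval_rename (f : σ → τ) (φ : ArithExpr k σ) :
    (φ.rename f).eval = MvPolynomial.rename f φ.eval := by
  induction φ with
  | var i => simp [rename]
  | const c => simp [rename]
  | add φ₁ φ₂ ih₁ ih₂ => simp [rename, ih₁, ih₂]
  | mul φ₁ φ₂ ih₁ ih₂ => simp [rename, ih₁, ih₂]

/-- The value of a list product is the product of the values. [cite: BurgisserClausenShokrollahi1997, (21.19)] -/
@[simp] theorem eval_listProd (l : List (ArithExpr k σ)) : (listProd l).eval = (l.map eval).prod := by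
  induction l with
  | nil => simp [listProd]
  | cons φ l ih => simp [listProd, ih]

/-- The expression `1 - φ`, written `1 + (-1)·φ`. [cite: BurgisserClausenShokrollahi1997, (21.19)] -/
def oneSub (φ : ArithExpr k σ) : ArithExpr k σ := add (const 1) (mul (const (-1)) φ)

/-- `E(1 - φ) = E(φ) + 2`. [cite: BurgisserClausenShokrollahi1997, (21.19)] -/
@[simp] theorem size_oneSub (φ : ArithExpr k σ) : φ.oneSub.size = φ.size + 2 := by
  simp [oneSub]

/-- `val(1 - φ) = 1 - val(φ)`. [cite: BurgisserClausenShokrollahi1997, (21.19)] -/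
@[simp] theorem eval_oneSub (φ : ArithExpr k σ) : φ.oneSub.eval = 1 - φ.eval := by
  simp [oneSub]; ring

end ArithExpr

/-! ### The gadgets of the transcript arithmetization as expressions -/

namespace CircuitArith

open Complexity ArithExpr

variable {k : Type u} [CommRing k] {τ : Type w}

/-- Expression form of the literal `lit c p` (`p` or `1 - p`). [cite: Burgisser2000, proof of Prop. 2.20] -/
def litE (c : Bool) (p : ArithExpr k τ) : ArithExpr k τ := if c then p else p.oneSub

/-- `val(litE c p) = lit c (val p)`. [cite: Burgisser2000, proof of Prop. 2.20] -/
@[simp] theorem eval_litE (c : Bool) (p : ArithExpr k τ) : (litE c p).eval = lit c p.eval := by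
  cases c <;> simp [litE, lit]

/-- `E(litE c p) ≤ E(p) + 2`. [cite: Burgisser2000, proof of Prop. 2.20] -/
theorem size_litE_le (c : Bool) (p : ArithExpr k τ) : (litE c p).size ≤ p.size + 2 := by
  cases c <;> simp [litE]

/-- One term `[T b₀ b₁] · lit b₀ u · lit b₁ v` of the truth-table extension, as an expression. [cite: Burgisser2000, proof of Prop. 2.20] -/
def termE (T : Bool → Bool → Bool) (u v : ArithExpr k τ) (b0 b1 : Bool) : ArithExpr k τ :=
  if T b0 b1 then mul (litE b0 u) (litE b1 v) else const 0

/-- Value of a term. [cite: Burgisser2000, proof of Prop. 2.20] -/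
theorem eval_termE (T : Bool → Bool → Bool) (u v : ArithExpr k τ) (b0 b1 : Bool) :
    (termE T u v b0 b1).eval = if T b0 b1 then lit b0 u.eval * lit b1 v.eval else 0 := by
  unfold termE
  split <;> simp

/-- Size of a term: `≤ E(u) + E(v) + 5`. [cite: Burgisser2000, proof of Prop. 2.20] -/
theorem size_termE_le (T : Bool → Bool → Bool) (u v : ArithExpr k τ) (b0 b1 : Bool) :
    (termE T u v b0 b1).size ≤ u.size + v.size + 5 := by
  unfold termE
  split
  · have h1 := size_litE_le b0 u
    have h2 := size_litE_le b1 v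
    simp only [size_mul]
    omega
  · simp

/-- Expression form of the multilinear extension `tableExt T u v` of a binary truth table (the
four terms, summed). [cite: Burgisser2000, proof of Prop. 2.20] -/
def tableExtE (T : Bool → Bool → Bool) (u v : ArithExpr k τ) : ArithExpr k τ :=
  add (add (termE T u v true true) (termE T u v true false))
    (add (termE T u v false true) (termE T u v false false))

/-- `val(tableExtE T u v) = tableExt T (val u) (val v)`. [cite: Burgisser2000, proof of Prop. 2.20] -/
@[simp] theorem eval_tableExtE (T : Bool → Bool → Bool) (u v : ArithExpr k τ) :
    (tableExtE T u v).eval = tableExt T u.eval v.eval := by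
  simp only [tableExtE, ArithExpr.eval_add, eval_termE, tableExt, Fintype.sum_bool]

/-- `E(tableExtE T u v) ≤ 4 (E(u) + E(v)) + 23`. [cite: Burgisser2000, proof of Prop. 2.20] -/
theorem size_tableExtE_le (T : Bool → Bool → Bool) (u v : ArithExpr k τ) :
    (tableExtE T u v).size ≤ 4 * (u.size + v.size) + 23 := by
  have h1 := size_termE_le T u v true true
  have h2 := size_termE_le T u v true false
  have h3 := size_termE_le T u v false true
  have h4 := size_termE_le T u v false false
  simp only [tableExtE, size_add]
  omega

/-- Expression form of the equality indicator `eqInd y t = y t + (1 - y)(1 - t)`. [cite: Burgisser2000, proof of Prop. 2.20] -/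
def eqIndE (y t : ArithExpr k τ) : ArithExpr k τ := add (mul y t) (mul y.oneSub t.oneSub)

/-- `val(eqIndE y t) = eqInd (val y) (val t)`. [cite: Burgisser2000, proof of Prop. 2.20] -/
@[simp] theorem eval_eqIndE (y t : ArithExpr k τ) : (eqIndE y t).eval = eqInd y.eval t.eval := by
  simp [eqIndE, eqInd]

/-- `E(eqIndE y t) = 2 (E(y) + E(t)) + 7`. [cite: Burgisser2000, proof of Prop. 2.20] -/
theorem size_eqIndE (y t : ArithExpr k τ) : (eqIndE y t).size = 2 * (y.size + t.size) + 7 := by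
  simp only [eqIndE, size_add, size_mul, size_oneSub]
  omega

variable {ι : Type v}

/-- Expression form of the wire polynomial: an input variable, a gate variable, or `0`. [cite: Burgisser2000, proof of Prop. 2.20] -/
def wirePolyE (s : ℕ) : ι ⊕ ℕ → ArithExpr k (ι ⊕ Fin s)
  | .inl i => var (.inl i)
  | .inr m => if h : m < s then var (.inr ⟨m, h⟩) else const 0

/-- `val(wirePolyE s w) = wirePoly s w`. [cite: Burgisser2000, proof of Prop. 2.20] -/
@[simp] theorem eval_wirePolyE (s : ℕ) (w : ι ⊕ ℕ) : (wirePolyE (k := k) s w).eval = wirePoly s w := by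
  cases w with
  | inl i => simp [wirePolyE, wirePoly]
  | inr m => by_cases h : m < s <;> simp [wirePolyE, wirePoly, h]

/-- Wire expressions have size `0`. [cite: Burgisser2000, proof of Prop. 2.20] -/
@[simp] theorem size_wirePolyE (s : ℕ) (w : ι ⊕ ℕ) : (wirePolyE (k := k) s w).size = 0 := by
  cases w with
  | inl i => rfl
  | inr m => by_cases h : m < s <;> simp [wirePolyE, h]

/-- Expression form of the polynomial of argument `a` of a gate. [cite: Burgisser2000, proof of Prop. 2.20] -/
def argPolyE (s : ℕ) (g : Gate ι) (a : ℕ) : ArithExpr k (ι ⊕ Fin s) :=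
  if h : a < g.arity then wirePolyE s (g.args ⟨a, h⟩) else const 0

/-- `val(argPolyE s g a) = argPoly s g a`. [cite: Burgisser2000, proof of Prop. 2.20] -/
@[simp] theorem eval_argPolyE (s : ℕ) (g : Gate ι) (a : ℕ) : (argPolyE (k := k) s g a).eval = argPoly s g a := by
  unfold argPolyE argPoly
  split <;> simp

/-- Argument expressions have size `0`. [cite: Burgisser2000, proof of Prop. 2.20] -/
@[simp] theorem size_argPolyE (s : ℕ) (g : Gate ι) (a : ℕ) : (argPolyE (k := k) s g a).size = 0 := by
  unfold argPolyE; split <;> simp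

/-- Expression form of the consistency polynomial of gate `j`: `[Y_j = T_j(arg₀, arg₁)]`. [cite: Burgisser2000, proof of Prop. 2.20] -/
def consPolyE (Q : Circuit ι) (j : Fin Q.size) : ArithExpr k (ι ⊕ Fin Q.size) :=
  eqIndE (var (.inr j)) (tableExtE (btable (Q.gates[j.val]'j.isLt)) (argPolyE Q.size (Q.gates[j.val]'j.isLt) 0)
    (argPolyE Q.size (Q.gates[j.val]'j.isLt) 1))

/-- `val(consPolyE Q j) = consPoly Q j`. [cite: Burgisser2000, proof of Prop. 2.20] -/
@[simp] theorem eval_consPolyE (Q : Circuit ι) (j : Fin Q.size) : (consPolyE (k := k) Q j).eval = consPoly Q j := by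
  simp [consPolyE, consPoly]

/-- Each consistency expression has constant size `≤ 53`. [cite: Burgisser2000, proof of Prop. 2.20] -/
theorem size_consPolyE_le (Q : Circuit ι) (j : Fin Q.size) : (consPolyE (k := k) Q j).size ≤ 53 := by
  unfold consPolyE
  rw [size_eqIndE]
  have := size_tableExtE_le (k := k) (btable (Q.gates[j.val]'j.isLt)) (argPolyE Q.size (Q.gates[j.val]'j.isLt) 0)
    (argPolyE Q.size (Q.gates[j.val]'j.isLt) 1)
  simp only [size_argPolyE, add_zero, mul_zero, zero_add] at this
  simp only [size_var]
  omega

/-- **`VALID(Q)` as an expression**: the product over the gates of the consistency expressions. [cite: Burgisser2000, proof of Prop. 2.20] -/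
def validPolyE (Q : Circuit ι) : ArithExpr k (ι ⊕ Fin Q.size) :=
  listProd ((List.finRange Q.size).map (consPolyE Q))

/-- `val(validPolyE Q) = validPoly Q`. [cite: Burgisser2000, proof of Prop. 2.20] -/
@[simp] theorem eval_validPolyE (Q : Circuit ι) : (validPolyE (k := k) Q).eval = validPoly Q := by
  rw [validPolyE, eval_listProd, List.map_map, validPoly, Fin.prod_univ_def]
  congr 1
  exact List.map_congr_left fun j _ => eval_consPolyE Q j

/-- **`VALID(Q)` is an expression of linear size**: `E(validPolyE Q) ≤ 54 |Q|`
(Bürgisser 2000, proof of Prop. 2.20). [cite: Burgisser2000, proof of Prop. 2.20] -/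
theorem size_validPolyE_le (Q : Circuit ι) : (validPolyE (k := k) Q).size ≤ 54 * Q.size := by
  rw [validPolyE, size_listProd, List.map_map, List.length_map, List.length_finRange]
  have h : ((List.finRange Q.size).map (ArithExpr.size ∘ consPolyE (k := k) Q)).sum ≤ 53 * Q.size := by
    have := List.sum_le_card_nsmul ((List.finRange Q.size).map (ArithExpr.size ∘ consPolyE (k := k) Q)) 53
      (fun x hx => by
        obtain ⟨j, -, rfl⟩ := List.mem_map.1 hx
        exact size_consPolyE_le Q j)
    simpa [List.length_finRange, smul_eq_mul, mul_comm] using this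
  omega

end CircuitArith

end Literature.Computability.AlgebraicComplexity
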